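/-
Copyright (c) 2026 the pub-hodgecm-mathlib formalisation cell (harness21).  Prover seat hodgecm-mathlib-K2Liu-p11 (g0), Track B «K2-LIT»,
#184♮ = hLiu418 = `stmt-HodgeConjecture-24832`; LEAD F0P6-plan (g13) RULINGS M-156n (4) «A∞ ORGAN, two faces from one computation», M-157i′.
File (A∞-hol∕A∞-½), scalar `K`-type: the pole at `s = ½` and the holomorphic regular part of `c_k(s)`.  THEOREMS ONLY.
-/
import Summits.HodgeConjecture.HodgeConjecture.Theorems.K2LiuArchIntertwiningScalarValue   -- ★ (this seat) (A∞-B) FILE 2: the VALUE `c_k(s)`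
import Mathlib.Analysis.SpecialFunctions.Gamma.Deriv                                       -- `Complex.differentiableAt_Gamma`
import HarnessLib

/-!
# Crux `HLiu418`, A∞ organ, scalar `K`-type: `(2s − 1) · c_k(s) = R_k(s)` with `R_k` holomorphic on `{0 < re s}`; parity of `k` at `s = ½`

Cell `hodgecm-mathlib`, crux item hLiu418 = `stmt-HodgeConjecture-24832` (helper lane `--supports`, count-neutral).

★ FILE 2 `archIntertwining_archScalarSection_one_eq`: on `re s > ½`,
`c_k(s) := M_w(s) f⁰_{s,k}(1) = (1/8)·(4π⁴·e^{−iπk}·Γ₂(s+1+k/2)⁻¹·Γ₂(s+1−k/2)⁻¹·(Γ₂(2s)·4^{−2s}))`, `Γ₂(t) = πΓ(t)Γ(t−1)`.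
Since `Γ₂(2s) = πΓ(2s)Γ(2s−1) = πΓ(2s)²∕(2s−1)`, the TWO FACES of the A∞ organ on the scalar type are read off ONE formula:
* §1 `two_mul_sub_one_mul_hermTwoGamma` — `(2s−1)·Γ₂(2s) = π·Γ(2s)²` (`re s > ½`);
* §2 `archIntertwining_archScalarSection_one_regular (k) (hs : ½ < re s) : (2s−1)·c_k(s) = R_k(s)` with the REGULAR PART
  `R_k(s) = (1/8)·(4π⁴·e^{−iπk}·Γ₂(s+1+k/2)⁻¹·Γ₂(s+1−k/2)⁻¹·(π·Γ(2s)²·4^{−2s}))` (written out; no definition);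
* §3 `differentiableOn_regularPart (k) : R_k` is HOLOMORPHIC on `{0 < re s}` ((A∞-hol) raw material: `1/Γ₂` entire, `Γ(2s)` holomorphic there) —
  so `c_k` continues meromorphically to `{0 < re s}` with at most a simple pole at `s = ½`;
* §4 the value of `R_k` at `s = ½` ((A∞-½) raw material): `R_k(½) = (1/8)·(4π⁴·e^{−iπk}·Γ₂((3+k)/2)⁻¹·Γ₂((3−k)/2)⁻¹·(π/4))`, which
  VANISHES IFF `k` IS ODD (`regularPart_half_eq_zero_of_odd` ∕ `regularPart_half_ne_zero_of_even`: for odd `k` one of `Γ₂((3±k)/2) = πΓ(·)Γ(·−1)`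
  has a non-positive-integer argument, Mathlib's `Γ(−n) = 0`; for even `k` all four Gamma arguments are half-integers) — i.e. the unnormalised
  `M_w(s)` has a SIMPLE POLE at `½` on the scalar type `k` iff `k` is even, and is regular there iff `k` is odd.
References: [Shimura1982, (1.31)], [KudlaRallis1994 (citation only)] — derived here, not cited.
HONEST LABEL: HC_CM is proved only modulo the 7 printed citations (2 remaining named inputs: hLiu418 = stmt-HodgeConjecture-24832,
h413 = stmt-HodgeConjecture-24833) until rung 0 closes; count-neutral helper, closes no socket.
-/

set_option autoImplicit false
set_option linter.dupNamespace false

noncomputable section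

open Complex MeasureTheory Set Matrix
open scoped ComplexOrder

namespace Summit.HodgeConjecture.HodgeConjecture.Cruxes.HLiu418.K2LiuArchIntertwiningScalarPole

open Summit.HodgeConjecture.HodgeConjecture.Cruxes.HLiu418.K2LiuHermTwoGammaDefs
open Summit.HodgeConjecture.HodgeConjecture.Cruxes.HLiu418.K2LiuHermTwoXiZeroValue
open Summit.HodgeConjecture.HodgeConjecture.Cruxes.HLiu418.K2LiuArchInducedTubeDefs
open Summit.HodgeConjecture.HodgeConjecture.Cruxes.HLiu418.K2LiuArchIntertwiningScalarValue

/-! ## §1  `(2s − 1)·Γ₂(2s) = π·Γ(2s)²` -/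

/-- `(2s−1)·Γ₂(2s) = π·Γ(2s)²` for `2s − 1 ≠ 0` (`Γ(2s) = (2s−1)Γ(2s−1)`). [folklore] -/
theorem two_mul_sub_one_mul_hermTwoGamma {s : ℂ} (hs : 2 * s - 1 ≠ 0) :
    (2 * s - 1) * hermTwoGamma (2 * s) = (Real.pi : ℂ) * Complex.Gamma (2 * s) ^ 2 := by
  have h : Complex.Gamma (2 * s) = (2 * s - 1) * Complex.Gamma (2 * s - 1) := by
    rw [← Complex.Gamma_add_one _ hs, sub_add_cancel]
  rw [hermTwoGamma_def, h]
  ring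

/-! ## §2  The regular part -/

/-- **`(2s−1)·c_k(s) = R_k(s)`** on `re s > ½`, with the regular part written out:
`R_k(s) = (1/8)·(4π⁴·e^{−iπk}·Γ₂(s+1+k/2)⁻¹·Γ₂(s+1−k/2)⁻¹·(π·Γ(2s)²·4^{−2s}))`. [Shimura1982, (1.31)] -/
theorem archIntertwining_archScalarSection_one_regular (k : ℤ) {s : ℂ} (hs : 1 / 2 < s.re) :
    (2 * s - 1) * archIntertwining (archScalarSection k s) (1 : Matrix (Fin 2 ⊕ Fin 2) (Fin 2 ⊕ Fin 2) ℂ) =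
      (1 / 8 : ℂ) * (((4 * Real.pi ^ 4 : ℝ) : ℂ) * cexp (-(Real.pi * I) * k) * (hermTwoGamma (s + 1 + k / 2))⁻¹ *
        (hermTwoGamma (s + 1 - k / 2))⁻¹ * ((Real.pi : ℂ) * Complex.Gamma (2 * s) ^ 2 * (4 : ℂ) ^ (-(2 * s)))) := by
  have hs1 : 2 * s - 1 ≠ 0 := by
    intro h
    have h' := congrArg Complex.re h
    simp only [sub_re, mul_re, re_ofNat, im_ofNat, zero_mul, sub_zero, one_re, zero_re] at h'
    linarith
  rw [archIntertwining_archScalarSection_one_eq k hs, ← two_mul_sub_one_mul_hermTwoGamma hs1]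
  ring

/-! ## §3  Holomorphy of the regular part on `{0 < re s}` -/

/-- A point of `{0 < re}` is not a pole of `Γ`. [folklore] -/
theorem ne_neg_nat_of_re_pos {t : ℂ} (ht : 0 < t.re) (m : ℕ) : t ≠ -(m : ℂ) := by
  intro h
  have h' := congrArg Complex.re h
  simp only [neg_re, natCast_re] at h'
  have hm : (0 : ℝ) ≤ (m : ℝ) := Nat.cast_nonneg m
  linarith

/-- **THE REGULAR PART IS HOLOMORPHIC ON `{0 < re s}`** ((A∞-hol), scalar type): `1/Γ₂` is entire and `Γ(2s)` is holomorphic for `re s > 0`. -/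
theorem differentiableOn_regularPart (k : ℤ) :
    DifferentiableOn ℂ (fun s : ℂ =>
      (1 / 8 : ℂ) * (((4 * Real.pi ^ 4 : ℝ) : ℂ) * cexp (-(Real.pi * I) * k) * (hermTwoGamma (s + 1 + k / 2))⁻¹ *
        (hermTwoGamma (s + 1 - k / 2))⁻¹ * ((Real.pi : ℂ) * Complex.Gamma (2 * s) ^ 2 * (4 : ℂ) ^ (-(2 * s)))))
      {s : ℂ | 0 < s.re} := by
  intro s hs
  simp only [Set.mem_setOf_eq] at hs
  have hΓ : DifferentiableAt ℂ (fun s : ℂ => Complex.Gamma (2 * s)) s := by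
    have h2s : 0 < (2 * s).re := by
      simp only [mul_re, re_ofNat, im_ofNat, zero_mul, sub_zero]
      linarith
    exact (Complex.differentiableAt_Gamma _ (ne_neg_nat_of_re_pos h2s)).comp s (by fun_prop)
  have hpow : DifferentiableAt ℂ (fun s : ℂ => (4 : ℂ) ^ (-(2 * s))) s :=
    DifferentiableAt.const_cpow (by fun_prop) (Or.inl (by norm_num))
  have hα : DifferentiableAt ℂ (fun s : ℂ => (hermTwoGamma (s + 1 + k / 2))⁻¹) s := by
    have h := (differentiable_inv_hermTwoGamma_add (1 + k / 2)) s
    have he : (fun t : ℂ => (hermTwoGamma (1 + k / 2 + t))⁻¹) = fun t : ℂ => (hermTwoGamma (t + 1 + k / 2))⁻¹ := by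
      funext t
      rw [show (1 + k / 2 + t : ℂ) = t + 1 + k / 2 by ring]
    rw [he] at h
    exact h
  have hβ : DifferentiableAt ℂ (fun s : ℂ => (hermTwoGamma (s + 1 - k / 2))⁻¹) s := by
    have h := (differentiable_inv_hermTwoGamma_add (1 - k / 2)) s
    have he : (fun t : ℂ => (hermTwoGamma (1 - k / 2 + t))⁻¹) = fun t : ℂ => (hermTwoGamma (t + 1 - k / 2))⁻¹ := by
      funext t
      rw [show (1 - k / 2 + t : ℂ) = t + 1 - k / 2 by ring]
    rw [he] at h
    exact h
  exact ((differentiableAt_const _).mul (((((differentiableAt_const _).mul (differentiableAt_const _)).mul hα).mul hβ).mul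
    (((differentiableAt_const _).mul (hΓ.pow 2)).mul hpow))).differentiableWithinAt

/-! ## §4  The regular part at `s = ½`: parity of `k` -/

/-- The regular part at `s = ½` in closed form: `R_k(½) = (1/8)·(4π⁴·e^{−iπk}·Γ₂((3+k)/2)⁻¹·Γ₂((3−k)/2)⁻¹·(π/4))`
(`Γ(1) = 1`, `4^{−1} = 1/4`). [folklore] -/
theorem regularPart_half (k : ℤ) :
    (1 / 8 : ℂ) * (((4 * Real.pi ^ 4 : ℝ) : ℂ) * cexp (-(Real.pi * I) * k) * (hermTwoGamma ((1 / 2 : ℂ) + 1 + k / 2))⁻¹ *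
        (hermTwoGamma ((1 / 2 : ℂ) + 1 - k / 2))⁻¹ * ((Real.pi : ℂ) * Complex.Gamma (2 * (1 / 2 : ℂ)) ^ 2 * (4 : ℂ) ^ (-(2 * (1 / 2 : ℂ))))) =
      (1 / 8 : ℂ) * (((4 * Real.pi ^ 4 : ℝ) : ℂ) * cexp (-(Real.pi * I) * k) * (hermTwoGamma ((3 + k) / 2))⁻¹ *
        (hermTwoGamma ((3 - k) / 2))⁻¹ * ((Real.pi : ℂ) / 4)) := by
  have h1 : ((1 / 2 : ℂ) + 1 + k / 2) = (3 + k) / 2 := by ring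
  have h2 : ((1 / 2 : ℂ) + 1 - k / 2) = (3 - k) / 2 := by ring
  have h3 : (2 * (1 / 2 : ℂ)) = 1 := by ring
  rw [h1, h2, h3, Complex.Gamma_one, one_pow, mul_one, Complex.cpow_neg_one]
  ring

/-- `Γ₂` vanishes at the integers `≤ 1` (Mathlib convention `Γ(−n) = 0`): `Γ₂(1 − n) = π·Γ(1−n)·Γ(−n) = 0`. [folklore] -/
theorem hermTwoGamma_one_sub_nat (n : ℕ) : hermTwoGamma (1 - (n : ℂ)) = 0 := by
  rw [hermTwoGamma_def, show (1 - (n : ℂ) - 1) = -(n : ℂ) by ring, Complex.Gamma_neg_nat_eq_zero, mul_zero]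

/-- **ODD `k`: THE REGULAR PART VANISHES AT `s = ½`** (so `c_k` is regular at `½`; for `|k| ≥ 3` it even vanishes there):
for `k = 2j+1`, `Γ₂((3−k)/2) = Γ₂(1−j) = 0` if `j ≥ 0` and `Γ₂((3+k)/2) = Γ₂(2+j) = Γ₂(1 − (−j−1)) = 0` if `j ≤ −1`. [Shimura1982, (1.31)] -/
theorem regularPart_half_eq_zero_of_odd {k : ℤ} (hk : Odd k) :
    (1 / 8 : ℂ) * (((4 * Real.pi ^ 4 : ℝ) : ℂ) * cexp (-(Real.pi * I) * k) * (hermTwoGamma ((3 + k) / 2))⁻¹ *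
        (hermTwoGamma ((3 - k) / 2))⁻¹ * ((Real.pi : ℂ) / 4)) = 0 := by
  obtain ⟨j, rfl⟩ := hk
  rcases le_or_gt 0 j with hj | hj
  · -- `(3 − k)/2 = 1 − j`, `j = n : ℕ`
    obtain ⟨n, rfl⟩ := Int.eq_ofNat_of_zero_le hj
    have h : ((3 - ((2 * (n : ℤ) + 1 : ℤ) : ℂ)) / 2) = 1 - (n : ℂ) := by
      push_cast
      ring
    rw [h, hermTwoGamma_one_sub_nat, _root_.inv_zero]
    ring
  · -- `(3 + k)/2 = 2 + j = 1 − n` with `n = −j−1 : ℕ`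
    obtain ⟨n, hn⟩ := Int.eq_ofNat_of_zero_le (show 0 ≤ -j - 1 by omega)
    have hj' : (j : ℂ) = -(n : ℂ) - 1 := by
      have : (j : ℤ) = -(n : ℤ) - 1 := by omega
      exact_mod_cast this
    have h : ((3 + ((2 * j + 1 : ℤ) : ℂ)) / 2) = 1 - (n : ℂ) := by
      push_cast
      rw [hj']
      ring
    rw [h, hermTwoGamma_one_sub_nat, _root_.inv_zero]
    ring

/-- A half-integer `m + ½` (`m : ℤ`) is never a non-positive integer. [folklore] -/
theorem int_add_half_ne_neg_nat (m : ℤ) (n : ℕ) : (m : ℂ) + 1 / 2 ≠ -(n : ℂ) := by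
  intro h
  have h' := congrArg Complex.im h
  have h'' := congrArg Complex.re h
  simp only [add_re, intCast_re, one_div, inv_re, re_ofNat, normSq_ofNat, neg_re, natCast_re] at h''
  have : (2 : ℝ) * (m : ℝ) + 1 = -2 * (n : ℝ) := by linarith
  have hz : (2 * m + 1 : ℤ) = -2 * (n : ℤ) := by exact_mod_cast this
  omega

/-- `Γ₂(m + 3/2) ≠ 0` for every integer `m` (both Gamma arguments `m + 3/2`, `m + 1/2` are half-integers). [folklore] -/
theorem hermTwoGamma_int_add_three_halves_ne_zero (m : ℤ) : hermTwoGamma ((m : ℂ) + 3 / 2) ≠ 0 := by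
  rw [hermTwoGamma_def]
  have hπ : (Real.pi : ℂ) ≠ 0 := by exact_mod_cast Real.pi_ne_zero
  have h1 : Complex.Gamma ((m : ℂ) + 3 / 2) ≠ 0 := by
    refine Complex.Gamma_ne_zero fun n => ?_
    have h := int_add_half_ne_neg_nat (m + 1) n
    push_cast at h
    rw [show ((m : ℂ) + 1 + 1 / 2) = (m : ℂ) + 3 / 2 by ring] at h
    exact h
  have h2 : Complex.Gamma ((m : ℂ) + 3 / 2 - 1) ≠ 0 := by
    refine Complex.Gamma_ne_zero fun n => ?_
    rw [show ((m : ℂ) + 3 / 2 - 1) = (m : ℂ) + 1 / 2 by ring]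
    exact int_add_half_ne_neg_nat m n
  exact mul_ne_zero (mul_ne_zero hπ h1) h2

/-- **EVEN `k`: THE REGULAR PART IS NON-ZERO AT `s = ½`** (so `c_k` has a SIMPLE POLE at `½`, residue `R_k(½)/2`):
for `k = 2j`, `(3 ± k)/2 = 3/2 ± j` and `Γ₂(3/2 ± j) ≠ 0`. [Shimura1982, (1.31)] -/
theorem regularPart_half_ne_zero_of_even {k : ℤ} (hk : Even k) :
    (1 / 8 : ℂ) * (((4 * Real.pi ^ 4 : ℝ) : ℂ) * cexp (-(Real.pi * I) * k) * (hermTwoGamma ((3 + k) / 2))⁻¹ *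
        (hermTwoGamma ((3 - k) / 2))⁻¹ * ((Real.pi : ℂ) / 4)) ≠ 0 := by
  obtain ⟨j, rfl⟩ := hk
  have hπ : (Real.pi : ℂ) ≠ 0 := by exact_mod_cast Real.pi_ne_zero
  have h1 : ((3 + ((j + j : ℤ) : ℂ)) / 2) = (j : ℂ) + 3 / 2 := by
    push_cast
    ring
  have h2 : ((3 - ((j + j : ℤ) : ℂ)) / 2) = ((-j : ℤ) : ℂ) + 3 / 2 := by
    push_cast
    ring
  rw [h1, h2]
  have hA := hermTwoGamma_int_add_three_halves_ne_zero j
  have hB := hermTwoGamma_int_add_three_halves_ne_zero (-j)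
  have h4 : ((4 * Real.pi ^ 4 : ℝ) : ℂ) ≠ 0 := by
    have : (4 * Real.pi ^ 4 : ℝ) ≠ 0 := by positivity
    exact_mod_cast this
  have hexp : cexp (-(Real.pi * I) * ((j + j : ℤ) : ℂ)) ≠ 0 := Complex.exp_ne_zero _
  have h8 : (1 / 8 : ℂ) ≠ 0 := by norm_num
  have hπ4 : (Real.pi : ℂ) / 4 ≠ 0 := div_ne_zero hπ (by norm_num)
  exact mul_ne_zero h8 (mul_ne_zero (mul_ne_zero (mul_ne_zero (mul_ne_zero h4 hexp) (inv_ne_zero hA)) (inv_ne_zero hB)) hπ4)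

end Summit.HodgeConjecture.HodgeConjecture.Cruxes.HLiu418.K2LiuArchIntertwiningScalarPole

end
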